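import Literature.Analysis.FluidPDE.SereginSverakLocalHolderBoundHolds
import HarnessLib

/-!
# Route HardyPointSink — `HardyAncientLimit`, step 3: the blow-up limit of a bounded sequence

Support file for item stmt-NavierStokesRegularity-9138 (`HardyAncientLimit`) of route
`HardyPointSink` (problem `NavierStokesRegularity`).

The compactness step (iv) of Seregin–Šverák 2009, §4 (arXiv:0804.1803, p. 11; = Seregin 2014,
§6.5, p. 125) in the general, non-axisymmetric setting, with the limit AND the convergence
exposed (the tree's `SereginSverak2009.blowupCompactness_of_localHolderBound` is the axisymmetric
twin and hides the limit behind an existential):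

* `HardyAncientLimit.exists_blowup_limit` — let `U_k` be velocity fields which, on every
  cylinder `Q(a) = 𝒞(a) × ]-a², 0[`, are for all large `k` continuous up to the top slice, bounded
  by `1`, and admit SOME pressure `P` making `(U_k, P)` a distributional Navier–Stokes solution in
  `Q(a)` with `∫_{Q(a)} |P|^{3/2} ≤ c(a)`. Then along a subsequence `U_{φ(j)} → W` uniformly on
  every compact cylinder-with-top `T_n = [-(n+1)², 0] × {|y'| ≤ n+1, |y₃| ≤ n+1}`, the limit `W`
  is continuous on `{s ≤ 0} × ℝ³`, bounded by `1`, and `w(t, x) = W(t, x)` is a bounded weak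
  solution of Navier–Stokes on `ℝ³ × ]-∞, 0[` in the class of Koch–Nadirashvili–Seregin–Šverák
  (accepted `IsBoundedWeakNSSolutionOn (Iio 0)`).

Proof: verbatim the tree's proof — the uniform local Hölder bound
(`SereginSverak2009.LocalHolderBound_holds`) on `Q(4a)`, `a = 2(n + 2)`, transferred to `U_k`
itself (`dist_repr_le_of_holderOnWith`), Arzelà–Ascoli with a diagonal subsequence
(`exists_strictMono_tendstoUniformlyOn`), and the passage to the limit in the distributional
identities (`SereginSverakBlowupLimit`).

## References

* G. Seregin, V. Šverák, Comm. PDE 34 (2009) = arXiv:0804.1803, §4 p. 11, (p5)–(p12).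
* G. Seregin, *Lecture notes on regularity theory for the Navier–Stokes equations* (2014), §6.5.
* G. Koch, N. Nadirashvili, G. Seregin, V. Šverák, Acta Math. 203 (2009), §4 (ii).
-/

noncomputable section

open Literature.Analysis.FluidPDE Literature.Analysis.FluidPDE.SereginSverak2009
open MeasureTheory Set Function Filter Topology Metric TopologicalSpace
open scoped ENNReal NNReal InnerProductSpace RealInnerProductSpace Laplacian

namespace Summit.NavierStokesRegularity.NavierStokesRegularity.Theorems

namespace HardyAncientLimit

/-- **The blow-up limit of a locally bounded sequence of Navier–Stokes velocities**
(Seregin–Šverák 2009, §4, step (iv); KNSS 2009, §4 (ii)). Let `U_k : ℝ → ℝ³ → ℝ³` be such that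
for every `a > 0`, for all large `k`: `U_k` is continuous on `𝒞(a) × ]-a², 0]`, `‖U_k‖ ≤ 1`
there, and there is a pressure `P` with `(U_k, P)` a distributional solution (`ν = 1`, no force)
in `Q(a) = 𝒞(a) × ]-a², 0[` and `∫_{Q(a)} |P|^{3/2} ≤ c(a)`. Then there are a strictly increasing
`φ` and `W : ℝ × ℝ³ → ℝ³`, continuous on `{s ≤ 0} × ℝ³` with `‖W‖ ≤ 1` there, such that
`U_{φ(j)} → W` uniformly on each `T_n = [-(n+1)², 0] × {|y'| ≤ n+1, |y₃| ≤ n+1}` (hence pointwise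
on `{s ≤ 0} × ℝ³`), and `(t, x) ↦ W(t, x)` is a bounded weak solution of Navier–Stokes on
`ℝ³ × ]-∞, 0[` (`IsBoundedWeakNSSolutionOn (Iio 0)`). -/
theorem exists_blowup_limit
    (U : ℕ → ℝ → EuclideanSpace ℝ (Fin 3) → EuclideanSpace ℝ (Fin 3))
    (hcont : ∀ a : ℝ, 0 < a → ∀ᶠ k in atTop, ContinuousOn (uncurry (U k)) (parCylTop a))
    (hb : ∀ a : ℝ, 0 < a → ∀ᶠ k in atTop, ∀ z ∈ parCylTop a, ‖U k z.1 z.2‖ ≤ 1)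
    (hNS : ∀ a : ℝ, 0 < a → ∃ cst : ℝ≥0, ∀ᶠ k in atTop,
      ∃ P : ℝ → EuclideanSpace ℝ (Fin 3) → ℝ,
        IsDistributionalNSSolutionOn (parCylOpens 0 a) 1 0 (U k) P ∧
        ∫⁻ z in parCyl 0 a, ‖P z.1 z.2‖ₑ ^ (3 / 2 : ℝ) ≤ cst) :
    ∃ (φ : ℕ → ℕ) (W : ℝ × EuclideanSpace ℝ (Fin 3) → EuclideanSpace ℝ (Fin 3)),
      StrictMono φ ∧
      ContinuousOn W (Iic 0 ×ˢ univ) ∧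
      (∀ z : ℝ × EuclideanSpace ℝ (Fin 3), z.1 ≤ 0 → ‖W z‖ ≤ 1) ∧
      (∀ n : ℕ, TendstoUniformlyOn (fun j => uncurry (U (φ j))) W atTop
        (Icc (-((n : ℝ) + 1) ^ 2) 0 ×ˢ
          {x : EuclideanSpace ℝ (Fin 3) | cylRadius x ≤ (n : ℝ) + 1 ∧ |x 2| ≤ (n : ℝ) + 1})) ∧
      (∀ z : ℝ × EuclideanSpace ℝ (Fin 3), z.1 ≤ 0 →
        Tendsto (fun j => uncurry (U (φ j)) z) atTop (𝓝 (W z))) ∧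
      IsBoundedWeakNSSolutionOn (Iio 0) isOpen_Iio 1 (fun t x => W (t, x)) := by
  -- the compact cylinders-with-top `T n = [-(n+1)², 0] × {|y'| ≤ n+1, |y₃| ≤ n+1}`
  set T : ℕ → Set (ℝ × EuclideanSpace ℝ (Fin 3)) := fun n => Icc (-((n : ℝ) + 1) ^ 2) 0 ×ˢ
    {x : EuclideanSpace ℝ (Fin 3) | cylRadius x ≤ (n : ℝ) + 1 ∧ |x 2| ≤ (n : ℝ) + 1} with hT
  have hTc : ∀ n, IsCompact (T n) := fun n => isCompact_closedTop ((n : ℝ) + 1)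
  set V : ℕ → ℝ × EuclideanSpace ℝ (Fin 3) → EuclideanSpace ℝ (Fin 3) := fun k => uncurry (U k)
    with hV
  /- Step 1: for each `n`, eventually in `k`: continuity, the bound `1` and a common Hölder
  modulus on `T n` (from `LocalHolderBound` on `Q(4a)`, `a = 2 (n + 2)`). -/
  have hstep1 : ∀ n : ℕ, ∃ K α : ℝ, 0 ≤ K ∧ 0 < α ∧ ∀ᶠ k in atTop,
      ContinuousOn (V k) (T n) ∧ (∀ z ∈ T n, ‖V k z‖ ≤ 1) ∧
      ∀ z ∈ T n, ∀ z' ∈ T n, dist (V k z) (V k z') ≤ K * dist z z' ^ α := by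
    intro n
    have hρ0 : (0 : ℝ) ≤ (n : ℝ) + 1 := by positivity
    set a : ℝ := 2 * ((n : ℝ) + 2) with ha
    have ha0 : 0 < a := by positivity
    have h4a0 : (0 : ℝ) < 4 * a := by positivity
    obtain ⟨c, hc⟩ := hNS (4 * a) h4a0
    obtain ⟨α, K, hα, hfact⟩ := LocalHolderBound_holds a ha0 c
    refine ⟨K, α, K.coe_nonneg, NNReal.coe_pos.2 hα, ?_⟩
    filter_upwards [hc, hcont a ha0, hb a ha0, hb (4 * a) h4a0] with k hck hcontk hbk hb4k
    obtain ⟨P, hP, hPb⟩ := hck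
    have hρa : (n : ℝ) + 1 < a := by rw [ha]; linarith
    have hTk : T n ⊆ parCylTop a := closedTop_subset_parCylTop hρ0 hρa
    refine ⟨hcontk.mono hTk, fun z hz => hbk z (hTk hz), ?_⟩
    have hb' : ∀ᵐ z ∂(volume.restrict (parCyl 0 (4 * a))), ‖U k z.1 z.2‖ ≤ 1 := by
      filter_upwards [ae_restrict_mem (isOpen_parCyl 0 (4 * a)).measurableSet] with z hz
      exact hb4k z (parCyl_zero_subset_parCylTop _ hz)
    obtain ⟨V', hV'U, hH⟩ := hfact (U k) P hP hb' hPb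
    have haR : a / 2 ≤ a := by linarith
    exact dist_repr_le_of_holderOnWith (U := U k) hcontk haR EventuallyEq.rfl hV'U hα hH hρ0
      (by rw [ha]; linarith)
  /- Step 2: the diagonal Arzelà–Ascoli extraction. -/
  choose K α hK hα hev using hstep1
  obtain ⟨φ, hφ, W, hW⟩ := exists_strictMono_tendstoUniformlyOn hTc hK hα hev
  /- Step 3: properties of the limit `W` on the closed half-space `{s ≤ 0} × ℝ³`. -/
  have hTmem : ∀ z : ℝ × EuclideanSpace ℝ (Fin 3), z.1 ≤ 0 →
      ∃ n, z ∈ T n ∧ T n ∈ 𝓝[Iic 0 ×ˢ univ] z := by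
    intro z hz
    obtain ⟨n, h1, h2, h3⟩ := exists_nat_lt_closedTop z
    exact ⟨n, ⟨⟨h1.le, hz⟩, h2.le, h3.le⟩, closedTop_mem_nhdsWithin h1 h2 h3⟩
  have hevφ : ∀ n, ∀ᶠ j in atTop, ContinuousOn (V (φ j)) (T n) ∧
      (∀ z ∈ T n, ‖V (φ j) z‖ ≤ 1) ∧
      ∀ z ∈ T n, ∀ z' ∈ T n, dist (V (φ j) z) (V (φ j) z') ≤ K n * dist z z' ^ α n :=
    fun n => hφ.tendsto_atTop.eventually (hev n)
  have hWcT : ∀ n, ContinuousOn W (T n) := fun n =>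
    (hW n).continuousOn ((hevφ n).mono fun j hj => hj.1).frequently
  have hWc : ContinuousOn W (Iic 0 ×ˢ univ) := by
    intro z hz
    obtain ⟨n, hzn, hn⟩ := hTmem z hz.1
    exact (hWcT n z hzn).mono_of_mem_nhdsWithin hn
  have hWc' : ContinuousOn W (Iio 0 ×ˢ univ) :=
    hWc.mono (prod_mono Iio_subset_Iic_self Subset.rfl)
  have hpt : ∀ n, ∀ z ∈ T n, Tendsto (fun j => V (φ j) z) atTop (𝓝 (W z)) := fun n z hz =>
    (hW n).tendsto_at hz
  have hpt' : ∀ z : ℝ × EuclideanSpace ℝ (Fin 3), z.1 ≤ 0 →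
      Tendsto (fun j => V (φ j) z) atTop (𝓝 (W z)) := by
    intro z hz
    obtain ⟨n, hzn, -⟩ := hTmem z hz
    exact hpt n z hzn
  -- `|W| ≤ 1`
  have hWb : ∀ z : ℝ × EuclideanSpace ℝ (Fin 3), z.1 ≤ 0 → ‖W z‖ ≤ 1 := by
    intro z hz
    obtain ⟨n, hzn, -⟩ := hTmem z hz
    exact le_of_tendsto (hpt n z hzn).norm ((hevφ n).mono fun j hj => hj.2.1 z hzn)
  -- the level-`N+1` distributional pairs, eventually along `φ`
  have hpair : ∀ N : ℕ, ∀ᶠ j in atTop, ∃ P : ℝ → EuclideanSpace ℝ (Fin 3) → ℝ,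
      IsDistributionalNSSolutionOn (parCylOpens 0 ((N : ℝ) + 1)) 1 0 (U (φ j)) P := by
    intro N
    obtain ⟨c, hc⟩ := hNS ((N : ℝ) + 1) (by positivity)
    filter_upwards [hφ.tendsto_atTop.eventually hc] with j hj
    obtain ⟨P, hP, -⟩ := hj
    exact ⟨P, hP⟩
  /- Step 4: the limit `w(t, x) = W(t, x)` has all the required properties. -/
  refine ⟨φ, W, hφ, hWc, hWb, hW, hpt', ⟨?_, ⟨1, fun t ht x => hWb (t, x) (le_of_lt ht)⟩, ?_, ?_⟩⟩
  · -- measurability on the slab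
    exact hWc'.aestronglyMeasurable (measurableSet_Iio.prod MeasurableSet.univ)
  · -- divergence-free slices for a.e. `t < 0`
    refine ae_isWeaklyDivFree_of_forall_spaceTimeTest hWc' (fun z hz => hWb z (le_of_lt hz.1))
      fun Θ hΘ => ?_
    have hK0 : tsupport (uncurry Θ) ⊆ Iio (0 : ℝ) ×ˢ (univ : Set (EuclideanSpace ℝ (Fin 3))) := by
      simpa only [coe_slab] using hΘ.tsupport_subset
    obtain ⟨N, hN⟩ := exists_nat_subset_parCyl hΘ.hasCompactSupport hK0
    have hN0 : (0 : ℝ) ≤ (N : ℝ) + 1 := by positivity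
    have hsub : parCyl 0 ((N : ℝ) + 1) ⊆ T N := parCyl_subset_closedTop ((N : ℝ) + 1)
    have hΘ' : IsSpaceTimeTestOn (⊤ : Opens (ℝ × EuclideanSpace ℝ (Fin 3))) Θ := hΘ.mono le_top
    have hlim := tendsto_setIntegral_inner_gradient ((hW N).mono hsub)
      ((hevφ N).mono fun j hj => hj.1.mono hsub) ((hevφ N).mono fun j hj z hz => hj.2.1 z (hsub hz))
      hΘ'
    have h0 : ∀ᶠ j in atTop,
        ∫ z in parCyl 0 ((N : ℝ) + 1), ⟪V (φ j) z, gradient (Θ z.1) z.2⟫ = 0 := by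
      filter_upwards [hpair N] with j hj
      obtain ⟨P, hP⟩ := hj
      exact setIntegral_inner_gradient_eq_zero hN0 le_rfl hP EventuallyEq.rfl hΘ' hN
    have hL : ∫ z in parCyl 0 ((N : ℝ) + 1), ⟪W z, gradient (Θ z.1) z.2⟫ = 0 :=
      tendsto_nhds_unique (hlim.congr' h0) tendsto_const_nhds
    rw [← setIntegral_inner_gradient_eq_integral W hN]
    exact hL
  · -- the weak Navier–Stokes identity against divergence-free test fields
    intro ψ hψ hdiv
    have hK0 : tsupport (uncurry ψ) ⊆ Iio (0 : ℝ) ×ˢ (univ : Set (EuclideanSpace ℝ (Fin 3))) := by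
      simpa only [coe_slab] using hψ.tsupport_subset
    obtain ⟨N, hN⟩ := exists_nat_subset_parCyl hψ.hasCompactSupport hK0
    have hN0 : (0 : ℝ) ≤ (N : ℝ) + 1 := by positivity
    have hsub : parCyl 0 ((N : ℝ) + 1) ⊆ T N := parCyl_subset_closedTop ((N : ℝ) + 1)
    have hψ' : IsSpaceTimeTestOn (⊤ : Opens (ℝ × EuclideanSpace ℝ (Fin 3))) ψ := hψ.mono le_top
    have hlim := tendsto_setIntegral_nsIntegrand ((hW N).mono hsub)
      ((hevφ N).mono fun j hj => hj.1.mono hsub) ((hevφ N).mono fun j hj z hz => hj.2.1 z (hsub hz))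
      hψ'
    have h0 : ∀ᶠ j in atTop, ∫ z in parCyl 0 ((N : ℝ) + 1), (⟪V (φ j) z, timeDeriv ψ z.1 z.2⟫ +
        ⟪V (φ j) z, fderiv ℝ (ψ z.1) z.2 (V (φ j) z)⟫ + ⟪V (φ j) z, Δ (ψ z.1) z.2⟫) = 0 := by
      filter_upwards [hpair N] with j hj
      obtain ⟨P, hP⟩ := hj
      exact setIntegral_nsIntegrand_eq_zero hN0 le_rfl hP EventuallyEq.rfl hψ' hN hdiv
    have hL : ∫ z in parCyl 0 ((N : ℝ) + 1), (⟪W z, timeDeriv ψ z.1 z.2⟫ +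
        ⟪W z, fderiv ℝ (ψ z.1) z.2 (W z)⟫ + ⟪W z, Δ (ψ z.1) z.2⟫) = 0 :=
      tendsto_nhds_unique (hlim.congr' h0) tendsto_const_nhds
    rw [setIntegral_nsIntegrand_eq_integral_Iio hWc' hψ' hN] at hL
    simpa only [convect_apply, one_mul] using hL

end HardyAncientLimit

end Summit.NavierStokesRegularity.NavierStokesRegularity.Theorems

end
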